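import Mathlib

/-!
# Above density `2/3`, exact additive coincidences force a linear-size affine piece

Companion (positive side) to `SoloInformedHalfDensityNoAffineRigidity`.  That file refutes the
seat's density-`θ` rigidity statement `(C_θ)` for every `θ ≤ 1/2` with an *exact* witness: a set
`S ⊆ [1, K]` of density `1/2` and a function `φ` with **no** violated additive coincidence on `S`
(`φ (a + u) - φ a = φ (b + u) - φ b` whenever `a, a + u, b, b + u ∈ S`) all of whose affine pieces
have size `≤ √K`.  Here we show that no such exact witness exists above density `2/3`:

* `soloTD_affine_piece_of_exact` — if `S ⊆ [0, N)`, `1 ≤ L` and `2 N + 2 L ≤ 3 · #S`, and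
  `φ : ℕ → G` (`G` any additive commutative group) has no violated additive coincidence on `S`,
  then `φ` is affine (`φ s = γ + s • μ`) on a block `T = S ∩ [jL, (j+1)L)` with
  `#S ≤ (N / L + 1) · #T`;
* `soloTD_exact_CTheta_of_gt_two_thirds` — the `(C_θ)`-shaped corollary: for every `θ > 2/3`
  there are `c₀ > 0` and `K₀` such that for `K ≥ K₀`, every `S ⊆ [1, K]` with `#S ≥ θ K` and
  every `φ : ℕ → ℂ` with no violated additive coincidence on `S` is affine on some `T ⊆ S` with
  `#T ≥ c₀ K`.

(The hypothesis "no violated additive coincidence" is the `V = ∅` case of the hypothesis of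
`(C_θ)`; the robust form, with up to `η₀ K³` violated coincidences, is not addressed here.)

The argument is elementary counting.  (1) For `S ⊆ [0, N)` the shifted copies `S`, `S - u`,
`S - u - v` meet in at least `3 #S - 2 N - 2 u - v` points (`soloTD_three_mul_card_le`), so above
density `2/3` every pattern `{a, a + u, a + u + 1} ⊆ S` with `u < L ≍ (3 #S - 2 N) / 2` occurs.
(2) Exactness makes the increment `ψ u = φ (a + u) - φ a` independent of `a`, and the patterns
give `ψ (u + 1) = ψ u + ψ 1`, whence `φ (a + u) = φ a + u • μ` for all `u ≤ L`
(`soloTD_increment_linear`).  (3) Some block of `L` consecutive integers contains at least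
`#S / (N / L + 1)` points of `S` (`soloTD_dense_block`), and on it `φ` is affine
(`soloTD_affine_on_block`).  The regime `#S > 2N/3` is the elementary end of Freiman's
`3k - 4` theory (small doubling ⇒ short arithmetic progression; see M. B. Nathanson, *Additive
Number Theory: Inverse Problems and the Geometry of Sumsets*, GTM 165 (1996), §1.5
Thms 1.13–1.16 and Ch. 8 on Freiman isomorphisms, and [cite: TaoVu2006, §5.3]); no novelty is
claimed.  Indeed for torsion-free divisible `G` (e.g. `ℂ`) more is classical: "no violated additive
coincidence" says that `φ` is a Freiman `2`-homomorphism on `S`, so the graph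
`A = {(s, φ s)} ⊆ ℤ × G` has `|A + A| = |S + S| ≤ 2N - 1`, and Freiman's lemma
(`rank A ≥ d ⇒ |A + A| ≥ (d+1)|A| - d(d+1)/2`, [cite: TaoVu2006, Lemma 5.13]) forces `A` to be
collinear, i.e. `φ` GLOBALLY affine on `S`, as soon as `#S > (2N + 2)/3`.  The statements below are
the weaker block form, for an arbitrary additive commutative group, by elementary counting.  So the
exact form of `(C_θ)` holds for every `θ > 2/3` and fails for every `θ ≤ 1/2`; the window
`(1/2, 2/3]` and the robust form are left open.  Role: a recorded bracket for the toy layer of this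
seat (node `RoyAdditiveDirichletExponent`); it introduces no definitions.
-/

namespace Summit.Schanuel.Schanuel.Theorems

open Finset

/-! ### Counting shifted copies -/

/-- The elements `a ∈ S` with `a + u ∈ S`, shifted by `u`, are exactly `(S + u) ∩ S`. -/
theorem soloTD_filter_map_eq (S : Finset ℕ) (u : ℕ) :
    (S.filter (fun a => a + u ∈ S)).map (addRightEmbedding u)
      = S.map (addRightEmbedding u) ∩ S := by
  ext x
  simp only [Finset.mem_map, Finset.mem_filter, Finset.mem_inter, addRightEmbedding_apply]
  constructor
  · rintro ⟨a, ⟨ha, hau⟩, rfl⟩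
    exact ⟨⟨a, ha, rfl⟩, hau⟩
  · rintro ⟨⟨a, ha, rfl⟩, hx⟩
    exact ⟨a, ⟨ha, hx⟩, rfl⟩

/-- **Pair count.**  For `S ⊆ [0, N)`: `#{a ∈ S : a + u ∈ S} ≥ 2 #S - N - u`. -/
theorem soloTD_two_mul_card_le {S : Finset ℕ} {N : ℕ} (hS : S ⊆ Finset.range N) (u : ℕ) :
    2 * S.card ≤ (S.filter (fun a => a + u ∈ S)).card + (N + u) := by
  have hcard : (S.filter (fun a => a + u ∈ S)).card
      = (S.map (addRightEmbedding u) ∩ S).card := by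
    rw [← Finset.card_map (addRightEmbedding u), soloTD_filter_map_eq]
  have hBcard : (S.map (addRightEmbedding u)).card = S.card := Finset.card_map _
  have hunion : (S.map (addRightEmbedding u) ∪ S) ⊆ Finset.range (N + u) := by
    intro x hx
    rcases Finset.mem_union.mp hx with hxB | hxS
    · obtain ⟨a, ha, rfl⟩ := Finset.mem_map.mp hxB
      have := Finset.mem_range.mp (hS ha)
      simp only [addRightEmbedding_apply, Finset.mem_range]
      omega
    · have := Finset.mem_range.mp (hS hxS)
      exact Finset.mem_range.mpr (by omega)
  have hU : (S.map (addRightEmbedding u) ∪ S).card ≤ N + u := by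
    simpa using Finset.card_le_card hunion
  have key := Finset.card_union_add_card_inter (S.map (addRightEmbedding u)) S
  omega

/-- **Triple count.**  For `S ⊆ [0, N)`:
`#{a ∈ S : a + u ∈ S ∧ a + u + v ∈ S} ≥ 3 #S - 2 N - 2 u - v`. -/
theorem soloTD_three_mul_card_le {S : Finset ℕ} {N : ℕ} (hS : S ⊆ Finset.range N) (u v : ℕ) :
    3 * S.card ≤ (S.filter (fun a => a + u ∈ S ∧ a + u + v ∈ S)).card + (2 * N + 2 * u + v) := by
  have h1 := soloTD_two_mul_card_le hS u
  have h2 := soloTD_two_mul_card_le hS (u + v)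
  have hPQ : S.filter (fun a => a + u ∈ S) ∩ S.filter (fun a => a + (u + v) ∈ S)
      = S.filter (fun a => a + u ∈ S ∧ a + u + v ∈ S) := by
    ext a
    simp only [Finset.mem_inter, Finset.mem_filter, add_assoc]
    tauto
  have hsub : S.filter (fun a => a + u ∈ S) ∪ S.filter (fun a => a + (u + v) ∈ S) ⊆ S :=
    Finset.union_subset (Finset.filter_subset _ _) (Finset.filter_subset _ _)
  have hU := Finset.card_le_card hsub
  have key := Finset.card_union_add_card_inter
    (S.filter (fun a => a + u ∈ S)) (S.filter (fun a => a + (u + v) ∈ S))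
  rw [hPQ] at key
  omega

/-! ### Exact increments are linear in the shift -/

/-- **Increment calculus.**  If `S ⊆ [0, N)` with `2 N + 2 L ≤ 3 #S`, `1 ≤ L`, and `φ` has no
violated additive coincidence on `S`, then there is `μ` with `φ (a + u) = φ a + u • μ` whenever
`u ≤ L` and `a, a + u ∈ S`. -/
theorem soloTD_increment_linear {G : Type*} [AddCommGroup G] {S : Finset ℕ} {N L : ℕ}
    (hS : S ⊆ Finset.range N) (hL : 2 * N + 2 * L ≤ 3 * S.card) (hL1 : 1 ≤ L) {φ : ℕ → G}
    (hex : ∀ a ∈ S, ∀ b ∈ S, ∀ u : ℕ, a + u ∈ S → b + u ∈ S →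
      φ (a + u) - φ a = φ (b + u) - φ b) :
    ∃ μ : G, ∀ u ≤ L, ∀ a ∈ S, a + u ∈ S → φ (a + u) = φ a + u • μ := by
  -- an element `a₁` with `a₁, a₁ + 1 ∈ S`
  have hne : (S.filter (fun a => a + 0 ∈ S ∧ a + 0 + 1 ∈ S)).Nonempty := by
    rw [← Finset.card_pos]
    have := soloTD_three_mul_card_le hS 0 1
    omega
  obtain ⟨a₁, ha₁⟩ := hne
  simp only [Finset.mem_filter, add_zero] at ha₁
  obtain ⟨ha₁S, -, ha₁S'⟩ := ha₁
  set μ := φ (a₁ + 1) - φ a₁ with hμ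
  refine ⟨μ, ?_⟩
  intro u
  induction u with
  | zero =>
    intro _ a _ _
    simp
  | succ u ih =>
    intro hu a ha hau
    -- an element `b` with `b, b + u, b + u + 1 ∈ S`
    have hne' : (S.filter (fun b => b + u ∈ S ∧ b + u + 1 ∈ S)).Nonempty := by
      rw [← Finset.card_pos]
      have := soloTD_three_mul_card_le hS u 1
      omega
    obtain ⟨b, hb⟩ := hne'
    simp only [Finset.mem_filter] at hb
    obtain ⟨hbS, hbu, hbu1⟩ := hb
    have hbu1' : b + (u + 1) ∈ S := by simpa [add_assoc] using hbu1
    have e1 : φ (a + (u + 1)) - φ a = φ (b + (u + 1)) - φ b := hex a ha b hbS (u + 1) hau hbu1'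
    have e2 : φ (b + u + 1) - φ (b + u) = μ := hex (b + u) hbu a₁ ha₁S 1 hbu1 ha₁S'
    have e3 : φ (b + u) = φ b + u • μ := ih (by omega) b hbS hbu
    rw [succ_nsmul]
    calc φ (a + (u + 1))
        = (φ (a + (u + 1)) - φ a) + φ a := by abel
      _ = (φ (b + (u + 1)) - φ b) + φ a := by rw [e1]
      _ = (φ (b + u + 1) - φ (b + u)) + (φ (b + u) - φ b) + φ a := by
          rw [← add_assoc b u 1]; abel
      _ = μ + (φ (b + u) - φ b) + φ a := by rw [e2]
      _ = μ + u • μ + φ a := by rw [e3]; abel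
      _ = φ a + (u • μ + μ) := by abel

/-! ### A dense block, and affinity on it -/

/-- **Dense block.**  For `S ⊆ [0, N)`, some block `[jL, (j+1)L)` carries at least
the average share of `S`: `#S ≤ (N / L + 1) · #{s ∈ S : s / L = j}`. -/
theorem soloTD_dense_block {S : Finset ℕ} {N : ℕ} (hS : S ⊆ Finset.range N) (L : ℕ) :
    ∃ j : ℕ, S.card ≤ (N / L + 1) * (S.filter (fun s => s / L = j)).card := by
  have hmaps : ∀ s ∈ S, s / L ∈ Finset.range (N / L + 1) := by
    intro s hs
    have h := Finset.mem_range.mp (hS hs)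
    have : s / L ≤ N / L := Nat.div_le_div_right h.le
    exact Finset.mem_range.mpr (by omega)
  have htne : (Finset.range (N / L + 1)).Nonempty := ⟨0, by simp⟩
  obtain ⟨j, -, hjmax⟩ := Finset.exists_max_image (Finset.range (N / L + 1))
    (fun y => (S.filter (fun s => s / L = y)).card) htne
  refine ⟨j, ?_⟩
  calc S.card = ∑ y ∈ Finset.range (N / L + 1), (S.filter (fun s => s / L = y)).card :=
        Finset.card_eq_sum_card_fiberwise hmaps
    _ ≤ ∑ _y ∈ Finset.range (N / L + 1), (S.filter (fun s => s / L = j)).card :=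
        Finset.sum_le_sum hjmax
    _ = (N / L + 1) * (S.filter (fun s => s / L = j)).card := by
        rw [Finset.sum_const, smul_eq_mul, Finset.card_range]

/-- **Affinity on a block.**  If increments are linear up to shift `L` (`1 ≤ L`), then `φ` is
affine on each block `{s ∈ S : s / L = j}`. -/
theorem soloTD_affine_on_block {G : Type*} [AddCommGroup G] {S : Finset ℕ} {L : ℕ} (j : ℕ)
    (hL1 : 1 ≤ L) {μ : G} {φ : ℕ → G}
    (hlin : ∀ u ≤ L, ∀ a ∈ S, a + u ∈ S → φ (a + u) = φ a + u • μ) :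
    ∃ γ : G, ∀ s ∈ S.filter (fun s => s / L = j), φ s = γ + s • μ := by
  by_cases hT : (S.filter (fun s => s / L = j)).Nonempty
  · set s₀ := (S.filter (fun s => s / L = j)).min' hT with hs₀def
    have hs₀ : s₀ ∈ S.filter (fun s => s / L = j) := Finset.min'_mem _ hT
    have hs₀' := Finset.mem_filter.mp hs₀
    refine ⟨φ s₀ - s₀ • μ, ?_⟩
    intro s hs
    have hle : s₀ ≤ s := Finset.min'_le _ s hs
    have hs' := Finset.mem_filter.mp hs
    obtain ⟨d, rfl⟩ := Nat.exists_eq_add_of_le hle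
    -- `d < L`: both `s₀` and `s₀ + d` lie in the block `j`
    have hd : d ≤ L := by
      have e1 := Nat.div_add_mod (s₀ + d) L
      have e2 := Nat.div_add_mod s₀ L
      rw [hs'.2] at e1
      rw [hs₀'.2] at e2
      have m1 : (s₀ + d) % L < L := Nat.mod_lt _ (by omega)
      have m2 : s₀ % L < L := Nat.mod_lt _ (by omega)
      set X := L * j with hX
      omega
    have key := hlin d hd s₀ hs₀'.1 hs'.1
    rw [key, add_nsmul]
    abel
  · exact ⟨0, fun s hs => (hT ⟨s, hs⟩).elim⟩

/-! ### The bracket: exactness above density `2/3` -/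

/-- **Exact additive coincidences above density `2/3` force a linear-size affine piece**
(combinatorial form).  `S ⊆ [0, N)`, `1 ≤ L`, `2 N + 2 L ≤ 3 #S`, `φ` with no violated additive
coincidence on `S` ⇒ `φ` is affine on some `T ⊆ S` with `#S ≤ (N / L + 1) · #T`. -/
theorem soloTD_affine_piece_of_exact {G : Type*} [AddCommGroup G] {S : Finset ℕ} {N L : ℕ}
    (hS : S ⊆ Finset.range N) (hL1 : 1 ≤ L) (hL : 2 * N + 2 * L ≤ 3 * S.card) {φ : ℕ → G}
    (hex : ∀ a ∈ S, ∀ b ∈ S, ∀ u : ℕ, a + u ∈ S → b + u ∈ S →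
      φ (a + u) - φ a = φ (b + u) - φ b) :
    ∃ T : Finset ℕ, T ⊆ S ∧ S.card ≤ (N / L + 1) * T.card ∧
      ∃ γ μ : G, ∀ s ∈ T, φ s = γ + s • μ := by
  obtain ⟨μ, hμ⟩ := soloTD_increment_linear hS hL hL1 hex
  obtain ⟨j, hj⟩ := soloTD_dense_block hS L
  obtain ⟨γ, hγ⟩ := soloTD_affine_on_block (S := S) j hL1 hμ
  exact ⟨S.filter (fun s => s / L = j), Finset.filter_subset _ _, hj, γ, μ, hγ⟩

/-- **The exact form of `(C_θ)` holds for every `θ > 2/3`.**  For `θ > 2/3` there are `c₀ > 0`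
and `K₀` such that for all `K ≥ K₀`, every `S ⊆ [1, K]` with `#S ≥ θ K` and every `φ : ℕ → ℂ`
with no violated additive coincidence on `S` is affine on some `T ⊆ S` with `#T ≥ c₀ K`.
(Compare `soloHD_not_CTheta_of_le_half`: at every `θ ≤ 1/2` there are exact witnesses whose
affine pieces have size `≤ √K`.) -/
theorem soloTD_exact_CTheta_of_gt_two_thirds {θ : ℝ} (hθ : 2 / 3 < θ) :
    ∃ c₀ : ℝ, 0 < c₀ ∧ ∃ K₀ : ℕ, ∀ K : ℕ, K₀ ≤ K →
      ∀ S : Finset ℕ, S ⊆ Finset.Icc 1 K → θ * K ≤ (S.card : ℝ) →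
        ∀ φ : ℕ → ℂ,
          (∀ a ∈ S, ∀ b ∈ S, ∀ u : ℕ, a + u ∈ S → b + u ∈ S →
            φ (a + u) - φ a = φ (b + u) - φ b) →
            ∃ T : Finset ℕ, T ⊆ S ∧ c₀ * K ≤ (T.card : ℝ) ∧
              ∃ γ μ : ℂ, ∀ s ∈ T, φ s = γ + (s : ℂ) * μ := by
  set δ : ℝ := θ - 2 / 3 with hδ
  have hδpos : 0 < δ := by rw [hδ]; linarith
  have hθpos : 0 < θ := by linarith
  set M : ℝ := 4 / δ + 1 with hM
  have hMpos : 0 < M := by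
    have : 0 < 4 / δ := div_pos (by norm_num) hδpos
    rw [hM]; linarith
  refine ⟨θ / M, div_pos hθpos hMpos, ⌈2 / δ⌉₊, ?_⟩
  intro K hK S hS hSθ φ hex
  -- real bookkeeping: `δ K ≥ 2`, `K ≥ 1`
  have hK2 : 2 ≤ δ * K := by
    have h1 : (2 / δ : ℝ) ≤ ⌈2 / δ⌉₊ := Nat.le_ceil _
    have h2 : ((⌈2 / δ⌉₊ : ℕ) : ℝ) ≤ K := by exact_mod_cast hK
    have h3 := (div_le_iff₀ hδpos).mp (h1.trans h2)
    linarith [mul_comm (K : ℝ) δ]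
  have hKpos : 0 < K := by
    rcases Nat.eq_zero_or_pos K with h | h
    · exfalso; subst h; norm_num at hK2
    · exact h
  have hK1 : (1 : ℝ) ≤ K := by exact_mod_cast hKpos
  -- the block length `L = ⌊δ K⌋`
  set L : ℕ := ⌊δ * K⌋₊ with hLdef
  have hLle : (L : ℝ) ≤ δ * K := Nat.floor_le (mul_nonneg hδpos.le (Nat.cast_nonneg K))
  have hLgt : δ * K < L + 1 := Nat.lt_floor_add_one _
  have hL2 : 2 ≤ L := by rw [hLdef]; exact Nat.le_floor (by exact_mod_cast hK2)
  have hL1 : 1 ≤ L := by omega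
  have hLhalf : δ * K / 2 ≤ L := by linarith
  -- `S ⊆ [0, K + 1)`
  have hS' : S ⊆ Finset.range (K + 1) := by
    intro s hs
    have := (Finset.mem_Icc.mp (hS hs)).2
    exact Finset.mem_range.mpr (by omega)
  -- the density hypothesis `2 (K + 1) + 2 L ≤ 3 #S`
  have hdens : 2 * (K + 1) + 2 * L ≤ 3 * S.card := by
    have h3 : 3 * θ * K = 2 * K + 3 * (δ * K) := by rw [hδ]; ring
    have : (2 * ((K : ℝ) + 1) + 2 * L) ≤ 3 * (S.card : ℝ) := by linarith
    exact_mod_cast this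
  obtain ⟨T, hTS, hT, γ, μ, hγ⟩ := soloTD_affine_piece_of_exact hS' hL1 hdens hex
  refine ⟨T, hTS, ?_, γ, μ, fun s hs => by rw [hγ s hs, nsmul_eq_mul]⟩
  -- `θ K / M ≤ #T` from `#S ≤ ((K+1)/L + 1) #T` and `(K+1)/L + 1 ≤ M`
  have hm : ((((K + 1) / L + 1 : ℕ)) : ℝ) ≤ M := by
    have h1 : ((((K + 1) / L : ℕ)) : ℝ) ≤ ((K : ℝ) + 1) / L := by
      have := Nat.cast_div_le (α := ℝ) (m := K + 1) (n := L)
      push_cast at this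
      exact this
    have h2 : ((K : ℝ) + 1) / L ≤ ((K : ℝ) + 1) / (δ * K / 2) :=
      div_le_div_of_nonneg_left (by positivity) (by linarith) hLhalf
    have h3 : ((K : ℝ) + 1) / (δ * K / 2) ≤ 4 / δ := by
      rw [div_le_div_iff₀ (by linarith) hδpos]
      nlinarith [mul_le_mul_of_nonneg_left hK1 hδpos.le]
    push_cast
    linarith
  have hT' : (S.card : ℝ) ≤ ((((K + 1) / L + 1 : ℕ)) : ℝ) * (T.card : ℝ) := by
    exact_mod_cast hT
  have hchain : θ * K ≤ M * (T.card : ℝ) :=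
    hSθ.trans (hT'.trans (mul_le_mul_of_nonneg_right hm (Nat.cast_nonneg _)))
  rw [div_mul_eq_mul_div, div_le_iff₀ hMpos]
  linarith [mul_comm M (T.card : ℝ)]

end Summit.Schanuel.Schanuel.Theorems
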